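import Mathlib
import HarnessLib

/-!
# The chain point is first-order critical: the tangent image of the Torelli map at a chain of three
# elliptic curves is the hyperplane of non-adjacent periods; the three chain types together span every direction
# (WEIL-2 gen 27, TORELLI-G27 §2–§3, fact-free linear-algebra core; docstrings revised gen 28, TRIPLE-G28 §1)

research route, not a corollary; conditional on HC_CM plus one named minimal statement.

Cell `pub-hodge-ring2-ab-*` (ALL ABELIAN VARIETIES), seat WEIL-2 gen 27, account
`run/shared/lean/pub/pub-hodge-ring2/pub-hodge-ring2-ab-weil-2/TORELLI-G27.md` §2 (THEOREM A), §3, §5; CORRECTION (gen 28):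
`…/TRIPLE-G28.md` §1 — TORELLI-G27 THEOREM C («the triple point `T` lifts to first order along all of `Sym`») is
WITHDRAWN: the first-order liftable space of `T` is the DIAGONAL span only (`N_T = ⊕_b ι_{b*} O²_{E_b}` has no pole slot
at the triple point, so each axis must lift on its own; equivalently the Torelli differential at the spine curve
`P¹ ∪ E₁ ∪ E₂ ∪ E₃` has image `diag`; finding habitat2 D-B77.1, confirmed by the author).  What the construction
`Θ_t × 0 ∪ q_t × E_c` of TORELLI-G27 3.1 gives is transport of `T` along ARCS after a ramified base change `t = s²`,
not a first-order lift.  The statements proved in this file are pure linear algebra and are unaffected; only the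
geometric gloss of `mem_tripleSpan_iff` changes (see its docstring).  The corrected `L(T) = diag` and the census of
all effective representatives are in `Theorems/Ring2AbelianAllNonsplitMinimalClassCensus.lean`.

Informal setting (not formalised).  Let `X₀ = E₁ × E₂ × E₃` be a product of elliptic curves with its product principal
polarisation; the tangent space of the polarised deformation space `A₃` at `X₀` is the space `Sym` of symmetric `3 × 3`
matrices `κ = (κ_ab)` (diagonal entries: deform the factors; off-diagonal entry `κ_ab`: turn on the period `τ_ab`).
Markman's Abel–Jacobi chain `C′ ⊂ X₀` (arXiv:2502.03415, Lemma 9.1.4–9.1.5) has middle component `E₂`; THEOREM A of the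
account shows that `C′` lifts to first order exactly along the image of the differential of the Torelli map at the stable
chain `E₁ – E₂ – E₃`, which is spanned by the three diagonal directions and the two ADJACENT off-diagonal directions
`S₀₁ = E₀₁ + E₁₀`, `S₁₂ = E₁₂ + E₂₁` (Fay, *Theta functions on Riemann surfaces*, Cor. 3.2).  This file is the exact
linear algebra:

* `mem_chainSpan_iff` — the span of `E₀₀, E₁₁, E₂₂, S₀₁, S₁₂` is the hyperplane `{κ ∈ Sym : κ₀₂ = 0}` (over any field);
* `s02_not_mem_chainSpan` — the non-adjacent direction `S₀₂` is not in it (the chain is obstructed along `τ₁₃`);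
* `mem_tripleSpan_iff` — adding `S₀₂` gives all of `Sym`: the first-order liftable spaces of the THREE chain types
  (middle `E₁`, `E₂`, `E₃`) together span `Sym`, and `Sym` is the set of directions along which `T` is carried by
  ramified arcs (gen-28 reading; the gen-27 reading «`T` is `6/6` to first order» is withdrawn);
* `commonDirections_iff` — the Sylvester count of §5: `diag(1,1,2) · A = A` iff the third row of `A` vanishes (the
  split anchor sees at most the 6 directions common to the cell and the split sibling at `E_ω⁶`).

0 sorry, no `def`, no named fact; `HC_CM` does not occur.  Indices `0,1,2` of `Fin 3` stand for the factors `E₁,E₂,E₃`.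

## References

* [Markman2025SecantWeil] E. Markman, Cycles on abelian 2n-folds of Weil type from secant sheaves on abelian
  n-folds, arXiv:2502.03415, §9.1 (the chain `C′`, Lemma 9.1.4–9.1.5) — context only.
* [Fay1973ThetaFunctions] J. D. Fay, Theta functions on Riemann surfaces, LNM 352, Ch. III, Cor. 3.2 — context only.
-/

namespace Summit.HodgeConjecture.Ring2AbelianAll.NonsplitChainTorelli

open Matrix

variable {L : Type*} [Field L]

/-- **Chain span ⊆ hyperplane.**  Every matrix in the span of `E₀₀, E₁₁, E₂₂, S₀₁, S₁₂` (diagonal directions and the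
two adjacent smoothing directions of the chain `E₁ – E₂ – E₃`) is symmetric with vanishing `(0,2)` entry.
research route, not a corollary; conditional on HC_CM plus one named minimal statement. [locator TORELLI-G27 §2 THEOREM A] -/
theorem transpose_eq_and_entry_eq_zero_of_mem_chainSpan (X : Matrix (Fin 3) (Fin 3) L)
    (hX : X ∈ Submodule.span L
      ({!![1, 0, 0; 0, 0, 0; 0, 0, 0], !![0, 0, 0; 0, 1, 0; 0, 0, 0], !![0, 0, 0; 0, 0, 0; 0, 0, 1],
        !![0, 1, 0; 1, 0, 0; 0, 0, 0], !![0, 0, 0; 0, 0, 1; 0, 1, 0]} : Set (Matrix (Fin 3) (Fin 3) L))) :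
    Xᵀ = X ∧ X 0 2 = 0 := by
  let K : Submodule L (Matrix (Fin 3) (Fin 3) L) :=
    { carrier := {Y | Yᵀ = Y ∧ Y 0 2 = 0}
      add_mem' := by
        rintro A B ⟨hA, hA'⟩ ⟨hB, hB'⟩
        exact ⟨by rw [Matrix.transpose_add, hA, hB], by simp [hA', hB']⟩
      zero_mem' := by simp
      smul_mem' := by
        rintro c A ⟨hA, hA'⟩
        exact ⟨by rw [Matrix.transpose_smul, hA], by simp [hA']⟩ }
  have hle : Submodule.span L
      ({!![1, 0, 0; 0, 0, 0; 0, 0, 0], !![0, 0, 0; 0, 1, 0; 0, 0, 0], !![0, 0, 0; 0, 0, 0; 0, 0, 1],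
        !![0, 1, 0; 1, 0, 0; 0, 0, 0], !![0, 0, 0; 0, 0, 1; 0, 1, 0]} : Set (Matrix (Fin 3) (Fin 3) L)) ≤ K := by
    refine Submodule.span_le.2 ?_
    intro Y hY
    simp only [Set.mem_insert_iff, Set.mem_singleton_iff] at hY
    rcases hY with rfl | rfl | rfl | rfl | rfl <;>
      exact ⟨by ext i j; fin_cases i <;> fin_cases j <;> simp [Matrix.transpose_apply], by simp⟩
  exact hle hX

/-- **Hyperplane ⊆ chain span.**  A symmetric matrix with vanishing `(0,2)` entry is a combination of
`E₀₀, E₁₁, E₂₂, S₀₁, S₁₂`.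
research route, not a corollary; conditional on HC_CM plus one named minimal statement. [locator TORELLI-G27 §2 THEOREM A] -/
theorem mem_chainSpan_of_transpose_eq (X : Matrix (Fin 3) (Fin 3) L) (hX : Xᵀ = X) (h02 : X 0 2 = 0) :
    X ∈ Submodule.span L
      ({!![1, 0, 0; 0, 0, 0; 0, 0, 0], !![0, 0, 0; 0, 1, 0; 0, 0, 0], !![0, 0, 0; 0, 0, 0; 0, 0, 1],
        !![0, 1, 0; 1, 0, 0; 0, 0, 0], !![0, 0, 0; 0, 0, 1; 0, 1, 0]} : Set (Matrix (Fin 3) (Fin 3) L)) := by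
  have h10 : X 1 0 = X 0 1 := by
    have := congrFun (congrFun hX 1) 0
    exact (by simpa [Matrix.transpose_apply] using this : X 0 1 = X 1 0).symm
  have h21 : X 2 1 = X 1 2 := by
    have := congrFun (congrFun hX 2) 1
    exact (by simpa [Matrix.transpose_apply] using this : X 1 2 = X 2 1).symm
  have h20 : X 2 0 = 0 := by
    have := congrFun (congrFun hX 2) 0
    have h' : X 0 2 = X 2 0 := by simpa [Matrix.transpose_apply] using this
    rw [← h', h02]
  have hdec : X = X 0 0 • (!![1, 0, 0; 0, 0, 0; 0, 0, 0] : Matrix (Fin 3) (Fin 3) L)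
      + X 1 1 • !![0, 0, 0; 0, 1, 0; 0, 0, 0] + X 2 2 • !![0, 0, 0; 0, 0, 0; 0, 0, 1]
      + X 0 1 • !![0, 1, 0; 1, 0, 0; 0, 0, 0] + X 1 2 • !![0, 0, 0; 0, 0, 1; 0, 1, 0] := by
    ext i j
    fin_cases i <;> fin_cases j <;> simp [h10, h21, h20, h02]
  rw [hdec]
  refine Submodule.add_mem _ (Submodule.add_mem _ (Submodule.add_mem _ (Submodule.add_mem _ ?_ ?_) ?_) ?_) ?_ <;>
    exact Submodule.smul_mem _ _ (Submodule.subset_span (by simp))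

/-- **THEOREM A (core).**  The span of the diagonal directions and the two adjacent smoothing directions is exactly the
hyperplane `{κ symmetric, κ₀₂ = 0}` of `Sym`: the first-order image of the Torelli map at the chain `E₁ – E₂ – E₃`
misses precisely the period `τ₁₃` of the two NON-adjacent components.
research route, not a corollary; conditional on HC_CM plus one named minimal statement. [locator TORELLI-G27 §2 THEOREM A] -/
theorem mem_chainSpan_iff (X : Matrix (Fin 3) (Fin 3) L) :
    X ∈ Submodule.span L
      ({!![1, 0, 0; 0, 0, 0; 0, 0, 0], !![0, 0, 0; 0, 1, 0; 0, 0, 0], !![0, 0, 0; 0, 0, 0; 0, 0, 1],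
        !![0, 1, 0; 1, 0, 0; 0, 0, 0], !![0, 0, 0; 0, 0, 1; 0, 1, 0]} : Set (Matrix (Fin 3) (Fin 3) L)) ↔
      (Xᵀ = X ∧ X 0 2 = 0) :=
  ⟨transpose_eq_and_entry_eq_zero_of_mem_chainSpan X, fun h => mem_chainSpan_of_transpose_eq X h.1 h.2⟩

/-- **The chain is obstructed along `τ₁₃`.**  The non-adjacent smoothing direction `S₀₂ = E₀₂ + E₂₀` does not lie in
the chain span.
research route, not a corollary; conditional on HC_CM plus one named minimal statement. [locator TORELLI-G27 §2 THEOREM A (ii)] -/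
theorem s02_not_mem_chainSpan :
    (!![0, 0, 1; 0, 0, 0; 1, 0, 0] : Matrix (Fin 3) (Fin 3) L) ∉ Submodule.span L
      ({!![1, 0, 0; 0, 0, 0; 0, 0, 0], !![0, 0, 0; 0, 1, 0; 0, 0, 0], !![0, 0, 0; 0, 0, 0; 0, 0, 1],
        !![0, 1, 0; 1, 0, 0; 0, 0, 0], !![0, 0, 0; 0, 0, 1; 0, 1, 0]} : Set (Matrix (Fin 3) (Fin 3) L)) := by
  intro h
  have h02 := (transpose_eq_and_entry_eq_zero_of_mem_chainSpan _ h).2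
  simp at h02

/-- **The three chain hyperplanes span `Sym`.**  Adding the third smoothing direction `S₀₂` to the chain span gives
all symmetric matrices: the diagonal together with the three pairwise period directions `S₀₁, S₁₂, S₀₂` is all of
`Sym`.  GEOMETRIC READING (revised gen 28, TRIPLE-G28 §1): `Sym` is the sum of the first-order liftable spaces of the
three CHAIN types at `E₁ × E₂ × E₃`, and the set of directions along which the triple point `T` is transported by
RAMIFIED arcs (`t = s²`); it is NOT the first-order liftable space of `T`, which is the diagonal span only
(`Ring2AbelianAllNonsplitMinimalClassCensus.offDiag_eq_zero_of_mem_diagSpan`; the gen-27 gloss «THEOREM C: `T` is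
`6/6`» is withdrawn — habitat2 D-B77.1, confirmed).
research route, not a corollary; conditional on HC_CM plus one named minimal statement. [locator TRIPLE-G28 §1; TORELLI-G27 §3] -/
theorem mem_tripleSpan_iff (X : Matrix (Fin 3) (Fin 3) L) :
    X ∈ Submodule.span L
      ({!![1, 0, 0; 0, 0, 0; 0, 0, 0], !![0, 0, 0; 0, 1, 0; 0, 0, 0], !![0, 0, 0; 0, 0, 0; 0, 0, 1],
        !![0, 1, 0; 1, 0, 0; 0, 0, 0], !![0, 0, 0; 0, 0, 1; 0, 1, 0], !![0, 0, 1; 0, 0, 0; 1, 0, 0]} :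
          Set (Matrix (Fin 3) (Fin 3) L)) ↔ Xᵀ = X := by
  constructor
  · intro hX
    let K : Submodule L (Matrix (Fin 3) (Fin 3) L) :=
      { carrier := {Y | Yᵀ = Y}
        add_mem' := by
          intro A B hA hB
          simp only [Set.mem_setOf_eq] at hA hB ⊢
          rw [Matrix.transpose_add, hA, hB]
        zero_mem' := by simp
        smul_mem' := by
          intro c A hA
          simp only [Set.mem_setOf_eq] at hA ⊢
          rw [Matrix.transpose_smul, hA] }
    have hle : Submodule.span L
        ({!![1, 0, 0; 0, 0, 0; 0, 0, 0], !![0, 0, 0; 0, 1, 0; 0, 0, 0], !![0, 0, 0; 0, 0, 0; 0, 0, 1],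
          !![0, 1, 0; 1, 0, 0; 0, 0, 0], !![0, 0, 0; 0, 0, 1; 0, 1, 0], !![0, 0, 1; 0, 0, 0; 1, 0, 0]} :
            Set (Matrix (Fin 3) (Fin 3) L)) ≤ K := by
      refine Submodule.span_le.2 ?_
      intro Y hY
      simp only [Set.mem_insert_iff, Set.mem_singleton_iff] at hY
      show Yᵀ = Y
      rcases hY with rfl | rfl | rfl | rfl | rfl | rfl <;>
        (ext i j; fin_cases i <;> fin_cases j <;> simp [Matrix.transpose_apply])
    exact hle hX
  · intro hX
    have h10 : X 1 0 = X 0 1 := by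
      have := congrFun (congrFun hX 1) 0
      exact (by simpa [Matrix.transpose_apply] using this : X 0 1 = X 1 0).symm
    have h21 : X 2 1 = X 1 2 := by
      have := congrFun (congrFun hX 2) 1
      exact (by simpa [Matrix.transpose_apply] using this : X 1 2 = X 2 1).symm
    have h20 : X 2 0 = X 0 2 := by
      have := congrFun (congrFun hX 2) 0
      exact (by simpa [Matrix.transpose_apply] using this : X 0 2 = X 2 0).symm
    have hdec : X = X 0 0 • (!![1, 0, 0; 0, 0, 0; 0, 0, 0] : Matrix (Fin 3) (Fin 3) L)
        + X 1 1 • !![0, 0, 0; 0, 1, 0; 0, 0, 0] + X 2 2 • !![0, 0, 0; 0, 0, 0; 0, 0, 1]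
        + X 0 1 • !![0, 1, 0; 1, 0, 0; 0, 0, 0] + X 1 2 • !![0, 0, 0; 0, 0, 1; 0, 1, 0]
        + X 0 2 • !![0, 0, 1; 0, 0, 0; 1, 0, 0] := by
      ext i j
      fin_cases i <;> fin_cases j <;> simp [h10, h21, h20]
    rw [hdec]
    refine Submodule.add_mem _ (Submodule.add_mem _ (Submodule.add_mem _ (Submodule.add_mem _
      (Submodule.add_mem _ ?_ ?_) ?_) ?_) ?_) ?_ <;>
      exact Submodule.smul_mem _ _ (Submodule.subset_span (by simp))

/-- **The Sylvester count (§5): common directions of the cell and the split sibling.**  With `T₊ = 1` and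
`T₋ = diag(1,1,2)` (the cell's polarisation as a rank-one modification of the split one at `E_ω⁶`), the Weil tangent
directions `A` (3 × 3 matrices) common to both families are the solutions of `T₋ · A = A · T₊ = A`, i.e. exactly the
matrices with vanishing third row — a 6-dimensional space.  (`2a = a ⇒ a = 0` holds in every ring, so no hypothesis on
the characteristic is needed.)
research route, not a corollary; conditional on HC_CM plus one named minimal statement. [locator TORELLI-G27 §5] -/
theorem commonDirections_iff (A : Matrix (Fin 3) (Fin 3) L) :
    Matrix.diagonal (![1, 1, 2] : Fin 3 → L) * A = A ↔ (A 2 0 = 0 ∧ A 2 1 = 0 ∧ A 2 2 = 0) := by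
  constructor
  · intro h
    have h0 := congrFun (congrFun h 2) 0
    have h1 := congrFun (congrFun h 2) 1
    have h2 := congrFun (congrFun h 2) 2
    simp only [Matrix.diagonal_mul, Matrix.cons_val_two, Matrix.tail_cons, Matrix.head_cons] at h0 h1 h2
    exact ⟨by linear_combination h0, by linear_combination h1, by linear_combination h2⟩
  · rintro ⟨h0, h1, h2⟩
    ext i j
    fin_cases i <;> fin_cases j <;> simp [Matrix.diagonal_mul, h0, h1, h2]

end Summit.HodgeConjecture.Ring2AbelianAll.NonsplitChainTorelli
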